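/-
Copyright: the b2b-balaban T⁴-continuum CRUX team, row NE7b OWNER lineage `t4-ne7b-p1` (gen 123). Project licence.
-/
import Summits.QuantumFields.BalabanUV.T4Continuum.Spine.NE7b.SupZdPropagatorLimit

/-!
# BOUNDED SOLUTIONS OF THE ROAD'S `ℤ^d` EQUATION ARE UNIQUE: for EVERY `V : ℤ^d → [−λ, Λ]` (`λ < min(2,a)`), `d ≥ 3`, every mesh, a BOUNDED
# `w : ℤ^d → ℝ` with `((n+1)²(−Δ) + a(n+1)^{−d}·(block sums) + V)w = 0` vanishes identically; hence (180)'s infinite-volume solution ∕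
# propagator is THE bounded solution — the window restriction `w∘wm_k` of `w` to the torus of coarse period `3^k` solves the torus
# equation with a source supported at the SEAM only (blocks at `ρ`-distance `≥ 3^k∕2 − 2` from the centre), so (178) `far_source_decay`
# bounds `|w(q₀)| ≤ K·e^{−δ(3^k∕2 − 2)}` for every `k` beyond the window radius of `q₀` (row NE7b, node U5c; (178)∕(179)∕(180) + the window kit
# BY NAME; [folklore])

Cell `pub-balaban`, sub-cell `t4`, spine estimate NE7b (`T4WeightBudget.RelWeightBound`; the cell's OWN estimate — NOT PRINTED in
[Bałaban 1983–89], NOT PROVED).  Crux-route work under `Spine/NE7b/` by the row OWNER (`t4-ne7b-p1` gen 123, file (181)) under FREEZE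
(0)'s crux-prover clause; NOTHING of Bałaban's is named as a Lean object, valued or asserted; no `T4Continuum/Support` leaf typed; no `def`,
no notation (the `ℤ^d` operator and the torus action DISPLAYED); zero `sorry`.  Imports (BY NAME): the OWNER's (180) `…SupZdPropagatorLimit`
(`inWindow_of_le`, `torusNorm_le_l1`; through it (179) `abs_le_side_mul`, (178) `far_source_decay`, TDF `blockOf_siteOf`, [B6] `mem_B`,
`sum_B_const`, the Literature window kit `Beta.InfiniteVolume` and `Beta.siteOf_add` ∕ `siteOf_sub`), Mathlib's
`tendsto_pow_atTop_nhds_zero_of_lt_one`, `ge_of_tendsto`.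

WHY (located).  (180) constructed the infinite-volume solution as a limit; to make it an OBJECT (the propagator of the road's class on
`ℓ^∞(ℤ^d)`) one needs uniqueness among bounded solutions.  No maximum principle is available on the class `V ≥ −λ`; instead the torus
column is used once more: restrict a bounded null solution `w` to the centred window of `T_k` (`w̃ = w∘wm_k`).  At a site whose block is
within `ρ`-distance `3^k∕2 − 2` of the centre, the site, its `2d` neighbours and its whole block lie inside the window (§1, the integer
bookkeeping of (179) for one period), so the torus action of `w̃` there READS the `ℤ^d` action of `w`, which is `0`; elsewhere it is
bounded by `(4d(n+1)² + a + |λ| + Λ)‖w‖_∞`.  (178) then gives `|w̃(σ_k q₀)| ≤ C·(…)·e^{δ|blk n q₀|₁}·e^{−δ(3^k∕2 − 2)}`, and `w̃(σ_k q₀) = w(q₀)`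
beyond the window radius of `q₀` ((180) `inWindow_of_le`); `k → ∞`.

WHAT IS PROVED ([folklore]; `X d = ℤ^d`, `T_k = Site d ((n+1)3^k)`; the `ℤ^d` operator `(Hu)(p) = (n+1)²Σ_μ(2u p − u(p + ê_μ) − u(p − ê_μ)) +
a(n+1)^{−d}Σ_{q ∈ B n (blk n p)}u q + V p·u p` DISPLAYED):
* §1 `two_abs_blk_lt_of_blockNorm_lt` (`q` in the window of `T` with coarse period `S`, torus norm of its block `< S∕2 − 2` ⟹ `2|blk n q i| + 4 < S`),
  `inWindow_near_of_blk` (then every `q′` with `blk n q′ = blk n q`, and every `q ± ê_μ`, lies in the window).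
* §2 **`zd_bounded_null_solution_eq_zero`** (`d ≥ 3`, `a > 0`, `λ < min(2,a)`, `Λ ≥ 0`, `V : ℤ^d → [−λ, Λ]`, `|w| ≤ B`, `Hw = 0` on `ℤ^d` ⟹ `w = 0`),
  **`zd_bounded_solution_unique`** (two bounded solutions of `Hu = f` on `ℤ^d` coincide).
* §3 toy (`d = 3`).

HONEST (what this is NOT).  Uniqueness in `ℓ^∞(ℤ^d)` only (growing solutions are not excluded and do exist); `d ≥ 3` only; the LINEAR
column only; scalar skeleton ((A3), NC-NE7b-α UNRULED); nothing of the covariant propagators of [B4]–[B6]; nothing of Bałaban's.  BY-NAME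
EFFECT ON THE WALL: NONE.  NE7b NOT PRINTED ∕ NOT PROVED; spine PROVED 0∕9; rung (B)+1 — the programme's measures remain FINITE-torus
statements; NOT the mass gap, NOT Clay.  HONEST DEPENDENCY: continuum YM on T⁴ ⇐ BetaPertH ∧ nine spine estimates (0∕9 proved); BetaPertH ⇐
(D1) ∧ (D4) ∧ CAP+tail; G-an2-4 gates asym, D1 and NE2∕3∕4.
-/

set_option autoImplicit false

noncomputable section

namespace Summit.QuantumFields.BalabanUV.T4Continuum.NE7b.SupZdPropagatorUniqueness

open Real Filter Topology
open Literature.MathematicalPhysics.QuantumFieldTheory.Balaban1983to89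
open B6QGQLower276 (X e blk B side side_facts chart mem_B sum_B sum_B_const card_cube blk_chart)
open Beta (Site siteOf windowMap siteOf_windowMap siteOf_add siteOf_sub InWindow windowMap_siteOf inWindow_windowMap
  inWindow_of_two_mul_abs_lt)
open SupTorusDirichletForm (blockOf_siteOf)
open SupTorusFarSourceDecay (far_source_decay)
open SupTorusTowerComparison (abs_le_side_mul)
open SupZdPropagatorLimit (inWindow_of_le torusNorm_le_l1)

variable {d : ℕ}

/-! ## §1. Integer bookkeeping: near the centre, a site's neighbours and block lie inside the window -/

/-- **NEAR BLOCKS ARE SMALL**: `q` in the centred window of period `(n+1)S` and the torus norm of `σ_S(blk n q)` below `S∕2 − 2` ⟹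
`2|blk n q i| + 4 < S` for every `i` (the centred representative of `blk n q i` mod `S` is `blk n q i` itself: a nonzero multiple of `S`
would contradict `|2·blk n q i| ≤ S + 1`). [folklore] -/
theorem two_abs_blk_lt_of_blockNorm_lt (n S : ℕ) (q : X d) (hq : ∀ i, InWindow ((n + 1) * S) (q i))
    (hdist : ∑ i, ((((siteOf d S (blk n q)) i).valMinAbs.natAbs : ℕ) : ℝ) < (S : ℝ) / 2 - 2) (i : Fin d) :
    2 * |blk n q i| + 4 < S := by
  classical
  have hs : (0 : ℤ) < side n := (side_facts n).1
  have hside : side n = (n : ℤ) + 1 := rfl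
  have hN0 : (0 : ℤ) ≤ (S : ℤ) := by positivity
  have hterm : ((((siteOf d S (blk n q)) i).valMinAbs.natAbs : ℕ) : ℝ) < (S : ℝ) / 2 - 2 :=
    lt_of_le_of_lt (Finset.single_le_sum (f := fun j => ((((siteOf d S (blk n q)) j).valMinAbs.natAbs : ℕ) : ℝ))
      (fun _ _ => Nat.cast_nonneg _) (Finset.mem_univ i)) hdist
  set v : ℤ := ((siteOf d S (blk n q)) i).valMinAbs with hv
  have hvS : 2 * (v.natAbs : ℤ) + 4 < S := by
    have h1 : 2 * ((v.natAbs : ℕ) : ℝ) + 4 < S := by linarith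
    have h2 : ((2 * v.natAbs + 4 : ℕ) : ℝ) < ((S : ℕ) : ℝ) := by push_cast; exact h1
    have h3 : 2 * v.natAbs + 4 < S := by exact_mod_cast h2
    exact_mod_cast h3
  rw [Int.natCast_natAbs v] at hvS
  have hcoe : ((v : ZMod S)) = (((blk n q i : ℤ)) : ZMod S) := by rw [hv]; exact ZMod.coe_valMinAbs _
  obtain ⟨m, hm⟩ := (ZMod.intCast_eq_intCast_iff_dvd_sub v (blk n q i) S).1 hcoe
  obtain ⟨hqabs, hr0, hr1, hqeq⟩ := abs_le_side_mul n q i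
  set b : ℤ := blk n q i with hb
  set r : ℤ := q i % side n with hr
  obtain ⟨hw1, hw2⟩ := hq i
  push_cast at hw1 hw2
  have h2b_le : 2 * b ≤ S := by
    have h : side n * (2 * b) ≤ side n * S := by rw [hside]; nlinarith
    exact le_of_mul_le_mul_left h hs
  have h2b_ge : -(S : ℤ) - 1 ≤ 2 * b := by
    have h : side n * (-(S : ℤ)) < side n * (2 * (b + 1)) := by rw [hside]; nlinarith
    have := lt_of_mul_lt_mul_left h hs.le
    linarith
  have hm0 : m = 0 := by
    by_contra hm0
    have hm1 : 1 ≤ |m| := Int.one_le_abs hm0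
    have hNm : (S : ℤ) ≤ |(S : ℤ) * m| := by rw [abs_mul, abs_of_nonneg hN0]; exact le_mul_of_one_le_right hN0 hm1
    have hbv : |(S : ℤ) * m| ≤ |b| + |v| := by rw [← hm]; exact abs_sub _ _
    have hb2 : |2 * b| ≤ S + 1 := abs_le.2 ⟨by linarith, by linarith⟩
    rw [abs_mul, abs_two] at hb2
    linarith
  rw [hm0, mul_zero, sub_eq_zero] at hm
  rw [hm]; exact hvS

/-- **NEAR THE CENTRE, NEIGHBOURS AND BLOCK-MATES LIE INSIDE THE WINDOW**: if `2|blk n q i| + 4 < S` for all `i`, then every `q′` in the block of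
`q` and every `q ± ê_μ` lies in the centred window of period `(n+1)S`. [folklore] -/
theorem inWindow_near_of_blk (n S : ℕ) (q : X d) (hb : ∀ i, 2 * |blk n q i| + 4 < S) :
    (∀ q' : X d, blk n q' = blk n q → ∀ i, InWindow ((n + 1) * S) (q' i)) ∧
      (∀ (μ : Fin d) (i : Fin d), InWindow ((n + 1) * S) ((q + e μ) i) ∧ InWindow ((n + 1) * S) ((q - e μ) i)) := by
  have hs : (0 : ℤ) < side n := (side_facts n).1
  have hside : side n = (n : ℤ) + 1 := rfl
  -- a point `q′` with block `blk n q` has `2|q′ i| + 2 < (n+1)S`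
  have key : ∀ q' : X d, blk n q' = blk n q → ∀ i, 2 * |q' i| + 2 < (((n + 1) * S : ℕ) : ℤ) := by
    intro q' hq' i
    obtain ⟨hqabs, hr0, hr1, -⟩ := abs_le_side_mul n q' i
    rw [hq'] at hqabs
    have h1 : side n * (2 * |blk n q i|) < side n * ((S : ℤ) - 4) := mul_lt_mul_of_pos_left (by linarith [hb i]) hs
    push_cast
    rw [hside] at h1 hqabs hr1
    nlinarith
  refine ⟨fun q' hq' i => inWindow_of_two_mul_abs_lt (by linarith [key q' hq' i]), fun μ i => ⟨?_, ?_⟩⟩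
  · refine inWindow_of_two_mul_abs_lt ?_
    have h := key q rfl i
    have hqi : (q + e μ) i = q i + (if i = μ then 1 else 0) := by simp only [e, Pi.add_apply, Pi.single_apply]
    rw [hqi]
    have : |q i + (if i = μ then (1 : ℤ) else 0)| ≤ |q i| + 1 := by
      refine (abs_add_le _ _).trans ?_
      split_ifs <;> simp
    linarith
  · refine inWindow_of_two_mul_abs_lt ?_
    have h := key q rfl i
    have hqi : (q - e μ) i = q i - (if i = μ then 1 else 0) := by simp only [e, Pi.sub_apply, Pi.single_apply]
    rw [hqi]
    have : |q i - (if i = μ then (1 : ℤ) else 0)| ≤ |q i| + 1 := by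
      refine (abs_sub _ _).trans ?_
      split_ifs <;> simp
    linarith

/-! ## §2. THE END: bounded null solutions vanish; bounded solutions are unique -/

/-- **HEADLINE — A BOUNDED `w : ℤ^d → ℝ` WITH `((n+1)²(−Δ) + a(n+1)^{−d}·blocks + V)w = 0` IS ZERO**, for every `V : ℤ^d → [−λ, Λ]`
(`λ < min(2,a)`, `Λ ≥ 0`, `a > 0`), `d ≥ 3`, every mesh: the window restriction `w∘wm_k` solves the torus equation with a source supported at
the seam (§1), (178) `far_source_decay` on `T_k`, and `k → ∞` beyond the window radius of the evaluation point. [folklore] -/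
theorem zd_bounded_null_solution_eq_zero (hd : 3 ≤ d) (a : ℝ) (ha : 0 < a) {lam Lam : ℝ} (hlam : lam < min 2 a) (hLam : 0 ≤ Lam)
    (n : ℕ) (V : X d → ℝ) (hV : ∀ p, -lam ≤ V p) (hV' : ∀ p, V p ≤ Lam) (w : X d → ℝ) {Bw : ℝ} (hwB : ∀ p, |w p| ≤ Bw)
    (hw : ∀ p, ((n : ℝ) + 1) ^ 2 * ∑ μ, (2 * w p - w (p + e μ) - w (p - e μ))
      + a / ((n : ℝ) + 1) ^ d * ∑ q ∈ B n (blk n p), w q + V p * w p = 0) :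
    w = 0 := by
  classical
  obtain ⟨C, δ, hC, hδ, H178⟩ := far_source_decay (d := d) hd a ha hlam hLam
  have hdR : (0 : ℝ) ≤ d := Nat.cast_nonneg d
  have hB : 0 ≤ Bw := (abs_nonneg _).trans (hwB 0)
  have hn1 : (0 : ℝ) < (n : ℝ) + 1 := by positivity
  have hvol : (0 : ℝ) < ((n : ℝ) + 1) ^ d := by positivity
  set L : ℝ := |lam| + Lam with hL
  have hL0 : 0 ≤ L := by positivity
  have hVabs : ∀ p, |V p| ≤ L := fun p => by
    rw [hL, abs_le]; constructor <;> linarith [hV p, hV' p, le_abs_self lam, neg_abs_le lam]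
  set Mg : ℝ := (4 * d * ((n : ℝ) + 1) ^ 2 + a + L) * Bw with hMg
  set r : ℝ := exp (-(δ / 2)) with hr
  have hr0 : 0 ≤ r := (exp_pos _).le
  have hr1 : r < 1 := exp_lt_one_iff.2 (by linarith)
  funext q₀
  -- the bound at every level `k` beyond the window radius of `q₀`
  set k₀ : ℕ := 2 * ∑ i, (q₀ i).natAbs + 1 with hk₀
  have hlevel : ∀ k : ℕ, k₀ ≤ k → |w q₀| ≤ C * Mg * exp (δ * ∑ i, (((blk n q₀ i).natAbs : ℕ) : ℝ)) * exp (2 * δ) * r ^ k := by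
    intro k hk
    -- the window restriction and its torus action
    set wt : Site d ((n + 1) * 3 ^ k) → ℝ := fun x => w (windowMap d ((n + 1) * 3 ^ k) x) with hwt
    set g : Site d ((n + 1) * 3 ^ k) → ℝ := fun x =>
      ((n : ℝ) + 1) ^ 2 * ∑ μ, (2 * wt x - wt (x + siteOf d ((n + 1) * 3 ^ k) (e μ)) - wt (x - siteOf d ((n + 1) * 3 ^ k) (e μ)))
        + a / ((n : ℝ) + 1) ^ d * ∑ q ∈ B n (blk n (windowMap d ((n + 1) * 3 ^ k) x)), wt (siteOf d ((n + 1) * 3 ^ k) q)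
        + V (windowMap d ((n + 1) * 3 ^ k) x) * wt x with hg
    have hwt_eq : ∀ x, ((n : ℝ) + 1) ^ 2 * ∑ μ, (2 * wt x - wt (x + siteOf d ((n + 1) * 3 ^ k) (e μ)) - wt (x - siteOf d ((n + 1) * 3 ^ k) (e μ)))
        + a / ((n : ℝ) + 1) ^ d * ∑ q ∈ B n (blk n (windowMap d ((n + 1) * 3 ^ k) x)), wt (siteOf d ((n + 1) * 3 ^ k) q)
        + V (windowMap d ((n + 1) * 3 ^ k) x) * wt x = g x := fun x => rfl
    -- the torus action is bounded
    have hgM : ∀ x, |g x| ≤ Mg := by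
      intro x
      have hwtB : ∀ x', |wt x'| ≤ Bw := fun x' => hwB _
      have k1 : |((n : ℝ) + 1) ^ 2 * ∑ μ, (2 * wt x - wt (x + siteOf d ((n + 1) * 3 ^ k) (e μ)) - wt (x - siteOf d ((n + 1) * 3 ^ k) (e μ)))|
          ≤ ((n : ℝ) + 1) ^ 2 * (4 * d * Bw) := by
        rw [abs_mul, abs_of_pos (by positivity)]
        refine mul_le_mul_of_nonneg_left ?_ (by positivity)
        calc |∑ μ, (2 * wt x - wt (x + siteOf d ((n + 1) * 3 ^ k) (e μ)) - wt (x - siteOf d ((n + 1) * 3 ^ k) (e μ)))|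
            ≤ ∑ μ, |2 * wt x - wt (x + siteOf d ((n + 1) * 3 ^ k) (e μ)) - wt (x - siteOf d ((n + 1) * 3 ^ k) (e μ))| :=
              Finset.abs_sum_le_sum_abs _ _
          _ ≤ ∑ _μ : Fin d, 4 * Bw := Finset.sum_le_sum fun μ _ => by
              have a1 := hwtB x
              have a2 := hwtB (x + siteOf d ((n + 1) * 3 ^ k) (e μ))
              have a3 := hwtB (x - siteOf d ((n + 1) * 3 ^ k) (e μ))
              have t1 := abs_sub (2 * wt x - wt (x + siteOf d ((n + 1) * 3 ^ k) (e μ))) (wt (x - siteOf d ((n + 1) * 3 ^ k) (e μ)))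
              have t2 := abs_sub (2 * wt x) (wt (x + siteOf d ((n + 1) * 3 ^ k) (e μ)))
              rw [abs_mul, abs_two] at t2
              linarith
          _ = 4 * d * Bw := by simp [Finset.sum_const, Finset.card_univ]; ring
      have k2 : |a / ((n : ℝ) + 1) ^ d * ∑ q ∈ B n (blk n (windowMap d ((n + 1) * 3 ^ k) x)), wt (siteOf d ((n + 1) * 3 ^ k) q)| ≤ a * Bw := by
        rw [abs_mul, abs_of_nonneg (by positivity), div_mul_eq_mul_div, div_le_iff₀ hvol]
        refine (mul_le_mul_of_nonneg_left (Finset.abs_sum_le_sum_abs _ _) ha.le).trans ?_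
        calc a * ∑ q ∈ B n (blk n (windowMap d ((n + 1) * 3 ^ k) x)), |wt (siteOf d ((n + 1) * 3 ^ k) q)|
            ≤ a * ∑ _q ∈ B n (blk n (windowMap d ((n + 1) * 3 ^ k) x)), Bw :=
              mul_le_mul_of_nonneg_left (Finset.sum_le_sum fun q _ => hwtB _) ha.le
          _ = a * Bw * ((n : ℝ) + 1) ^ d := by rw [sum_B_const]; ring
      have k3 : |V (windowMap d ((n + 1) * 3 ^ k) x) * wt x| ≤ L * Bw := by
        rw [abs_mul]; exact mul_le_mul (hVabs _) (hwtB x) (abs_nonneg _) hL0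
      calc |g x| ≤ |((n : ℝ) + 1) ^ 2 * ∑ μ, (2 * wt x - wt (x + siteOf d ((n + 1) * 3 ^ k) (e μ)) - wt (x - siteOf d ((n + 1) * 3 ^ k) (e μ)))
            + a / ((n : ℝ) + 1) ^ d * ∑ q ∈ B n (blk n (windowMap d ((n + 1) * 3 ^ k) x)), wt (siteOf d ((n + 1) * 3 ^ k) q)|
            + |V (windowMap d ((n + 1) * 3 ^ k) x) * wt x| := abs_add_le _ _
        _ ≤ (((n : ℝ) + 1) ^ 2 * (4 * d * Bw) + a * Bw) + L * Bw := add_le_add ((abs_add_le _ _).trans (add_le_add k1 k2)) k3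
        _ = Mg := by rw [hMg]; ring
    -- the torus action vanishes near the centre: it reads the `ℤ^d` action there
    have hg0 : ∀ x, ∑ i, ((((siteOf d (3 ^ k) (blk n (windowMap d ((n + 1) * 3 ^ k) x))) i
        - (0 : Site d (3 ^ k)) i).valMinAbs.natAbs : ℕ) : ℝ) < ((3 ^ k : ℕ) : ℝ) / 2 - 2 → g x = 0 := by
      intro x hx
      set q : X d := windowMap d ((n + 1) * 3 ^ k) x with hq
      have hxq : x = siteOf d ((n + 1) * 3 ^ k) q := (siteOf_windowMap d ((n + 1) * 3 ^ k) x).symm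
      have hx' : ∑ i, ((((siteOf d (3 ^ k) (blk n q)) i).valMinAbs.natAbs : ℕ) : ℝ) < ((3 ^ k : ℕ) : ℝ) / 2 - 2 := by
        simpa only [Pi.zero_apply, sub_zero] using hx
      have hbk : ∀ i, 2 * |blk n q i| + 4 < ((3 ^ k : ℕ) : ℤ) :=
        two_abs_blk_lt_of_blockNorm_lt n (3 ^ k) q (inWindow_windowMap x) hx'
      obtain ⟨hblkwin, hnbwin⟩ := inWindow_near_of_blk n (3 ^ k) q hbk
      -- the values of `wt` at `x`, its neighbours and its block are values of `w` at `q`, its neighbours and its block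
      have hv0 : wt x = w q := rfl
      have hvp : ∀ μ, wt (x + siteOf d ((n + 1) * 3 ^ k) (e μ)) = w (q + e μ) := fun μ => by
        simp only [hwt]; rw [hxq, ← siteOf_add, windowMap_siteOf d ((n + 1) * 3 ^ k) (fun i => (hnbwin μ i).1)]
      have hvm : ∀ μ, wt (x - siteOf d ((n + 1) * 3 ^ k) (e μ)) = w (q - e μ) := fun μ => by
        simp only [hwt]; rw [hxq, ← siteOf_sub, windowMap_siteOf d ((n + 1) * 3 ^ k) (fun i => (hnbwin μ i).2)]
      have hvb : ∑ q' ∈ B n (blk n (windowMap d ((n + 1) * 3 ^ k) x)), wt (siteOf d ((n + 1) * 3 ^ k) q') = ∑ q' ∈ B n (blk n q), w q' := by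
        refine Finset.sum_congr rfl fun q' hq' => ?_
        simp only [hwt]
        rw [windowMap_siteOf d ((n + 1) * 3 ^ k) (hblkwin q' (mem_B.1 hq'))]
      simp only [hg, hv0, hvp, hvm, hvb]
      exact hw q
    -- (178) on `T_k` with centre `0` and radius `3^k∕2 − 2`
    have h := H178 n (3 ^ k) (fun x => V (windowMap d ((n + 1) * 3 ^ k) x)) (fun x => hV _) (fun x => hV' _) (0 : Site d (3 ^ k))
      (((3 ^ k : ℕ) : ℝ) / 2 - 2) Mg wt g hgM hg0 hwt_eq (siteOf d ((n + 1) * 3 ^ k) q₀)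
    simp only [Pi.zero_apply, sub_zero] at h
    rw [blockOf_siteOf n (3 ^ k) q₀] at h
    have hread : wt (siteOf d ((n + 1) * 3 ^ k) q₀) = w q₀ := by
      simp only [hwt]; rw [windowMap_siteOf d ((n + 1) * 3 ^ k) (inWindow_of_le n k q₀ (by rw [hk₀] at hk; exact hk))]
    rw [hread] at h
    have hwgt : exp (δ * ∑ i, ((((siteOf d (3 ^ k) (blk n q₀)) i).valMinAbs.natAbs : ℕ) : ℝ))
        ≤ exp (δ * ∑ i, (((blk n q₀ i).natAbs : ℕ) : ℝ)) :=
      exp_le_exp.2 (mul_le_mul_of_nonneg_left (torusNorm_le_l1 (d := d) (3 ^ k) (blk n q₀)) hδ.le)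
    have hkk : (k : ℝ) ≤ (3 : ℝ) ^ k := by exact_mod_cast (Nat.lt_pow_self (by norm_num : 1 < 3) (n := k)).le
    have hrate : exp (-(δ * ((((3 ^ k : ℕ)) : ℝ) / 2 - 2))) ≤ exp (2 * δ) * r ^ k := by
      rw [hr, ← Real.exp_nat_mul, ← exp_add]
      push_cast
      exact exp_le_exp.2 (by nlinarith)
    have hMg0 : 0 ≤ Mg := by positivity
    calc |w q₀| ≤ C * Mg * exp (δ * ∑ i, ((((siteOf d (3 ^ k) (blk n q₀)) i).valMinAbs.natAbs : ℕ) : ℝ))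
          * exp (-(δ * ((((3 ^ k : ℕ)) : ℝ) / 2 - 2))) := h
      _ ≤ C * Mg * exp (δ * ∑ i, (((blk n q₀ i).natAbs : ℕ) : ℝ)) * (exp (2 * δ) * r ^ k) :=
          mul_le_mul (mul_le_mul_of_nonneg_left hwgt (by positivity)) hrate (exp_pos _).le (by positivity)
      _ = _ := by ring
  -- `k → ∞`
  have hT : Tendsto (fun k : ℕ => C * Mg * exp (δ * ∑ i, (((blk n q₀ i).natAbs : ℕ) : ℝ)) * exp (2 * δ) * r ^ k) atTop (𝓝 0) := by
    have := (tendsto_pow_atTop_nhds_zero_of_lt_one hr0 hr1).const_mul (C * Mg * exp (δ * ∑ i, (((blk n q₀ i).natAbs : ℕ) : ℝ)) * exp (2 * δ))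
    rwa [mul_zero] at this
  have hle : |w q₀| ≤ 0 := ge_of_tendsto hT (Filter.eventually_atTop.2 ⟨k₀, fun k hk => hlevel k hk⟩)
  exact abs_nonpos_iff.1 hle

/-- **BOUNDED SOLUTIONS OF `Hu = f` ON `ℤ^d` ARE UNIQUE**: two bounded solutions of the displayed `ℤ^d` equation with the same source coincide —
the difference is a bounded null solution. [folklore] -/
theorem zd_bounded_solution_unique (hd : 3 ≤ d) (a : ℝ) (ha : 0 < a) {lam Lam : ℝ} (hlam : lam < min 2 a) (hLam : 0 ≤ Lam)
    (n : ℕ) (V : X d → ℝ) (hV : ∀ p, -lam ≤ V p) (hV' : ∀ p, V p ≤ Lam) (f u₁ u₂ : X d → ℝ) {B₁ B₂ : ℝ}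
    (hu₁B : ∀ p, |u₁ p| ≤ B₁) (hu₂B : ∀ p, |u₂ p| ≤ B₂)
    (hu₁ : ∀ p, ((n : ℝ) + 1) ^ 2 * ∑ μ, (2 * u₁ p - u₁ (p + e μ) - u₁ (p - e μ))
      + a / ((n : ℝ) + 1) ^ d * ∑ q ∈ B n (blk n p), u₁ q + V p * u₁ p = f p)
    (hu₂ : ∀ p, ((n : ℝ) + 1) ^ 2 * ∑ μ, (2 * u₂ p - u₂ (p + e μ) - u₂ (p - e μ))
      + a / ((n : ℝ) + 1) ^ d * ∑ q ∈ B n (blk n p), u₂ q + V p * u₂ p = f p) :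
    u₁ = u₂ := by
  have h := zd_bounded_null_solution_eq_zero hd a ha hlam hLam n V hV hV' (fun p => u₁ p - u₂ p) (Bw := B₁ + B₂)
    (fun p => (abs_sub _ _).trans (add_le_add (hu₁B p) (hu₂B p))) fun p => by
      have e1 : ∑ μ, (2 * (u₁ p - u₂ p) - (u₁ (p + e μ) - u₂ (p + e μ)) - (u₁ (p - e μ) - u₂ (p - e μ)))
          = ∑ μ, (2 * u₁ p - u₁ (p + e μ) - u₁ (p - e μ)) - ∑ μ, (2 * u₂ p - u₂ (p + e μ) - u₂ (p - e μ)) := by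
        rw [← Finset.sum_sub_distrib]; exact Finset.sum_congr rfl fun μ _ => by ring
      rw [e1, Finset.sum_sub_distrib (f := u₁) (g := u₂)]
      have h1 := hu₁ p
      have h2 := hu₂ p
      linarith
  funext p
  have := congrFun h p
  simp only [Pi.zero_apply] at this
  linarith

/-! ## §3. Toy -/

/-- Toy (`d = 3`, `a = 1`, `λ = 0`, `Λ = 1`, `n = 0`, `V = 0`): the zero function is the only bounded null solution — here checked on `w = 0`. -/
example : (fun _ : X 3 => (0 : ℝ)) = 0 :=
  zd_bounded_null_solution_eq_zero (d := 3) le_rfl 1 one_pos (lam := 0) (Lam := 1)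
    (by rw [min_eq_right (by norm_num : (1 : ℝ) ≤ 2)]; norm_num) zero_le_one 0 (fun _ => 0) (fun _ => by norm_num) (fun _ => zero_le_one)
    (fun _ => 0) (Bw := 0) (fun _ => by simp) (fun _ => by simp)

end Summit.QuantumFields.BalabanUV.T4Continuum.NE7b.SupZdPropagatorUniqueness
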